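import Mathlib
import Literature.Analysis.ODE.ViscosityLinearOneDim
import HarnessLib

/-!
# One-dimensional viscosity rigidity, second order: viscosity solutions of `A u'' + B u' = 0` are classical

Topic `Literature/Analysis/ODE`; theorems only.  Let `f` be continuous on `(a,b)` and `A, B`
smooth on `(a,b)` with `A > 0`.  If every smooth test function `φ` touching `f` from above at a
point `η₀ ∈ (a,b)` satisfies `A η₀ φ''(η₀) + B η₀ φ'(η₀) ≥ 0`, and every smooth `φ` touching from
below satisfies `≤ 0` (i.e. `f` is a continuous viscosity solution of the linear equation
`-(A u'' + B u') = 0`, Crandall–Ishii–Lions 1992, §2), then `f` is smooth on `(a,b)` and solves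
`A f'' + B f' = 0` classically (`contDiffOn_and_ode_of_touching`).  Proof: on each `[α, β] ⊂ (a,b)`
compare `f` with the explicit classical solution `u` of the two-point problem
(`exists_classical_twoPoint`: `u' ∝ exp(-∫ B/A)`) perturbed by `± ε (e^{K(β+1)} - e^{Kη})` with
`A K² + B K ≥ 1` (`le_classical_of_touchingAbove`; the lower bound is the upper bound for `-f`).
This is the second-order half of the regularity bootstrap used by the crux line
`crossing-martingale` of `CardyRigidity` (stmt-CriticalPhenomena-0746); the first-order half is
`ViscosityLinearOneDim.lean`.

Mathlib has no viscosity solutions; USED: `ContDiffBump` (via `exists_contDiff_eventuallyEq`),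
`intervalIntegral.integral_hasDerivAt_right`, `contDiffOn_infty_iff_deriv_of_isOpen`,
`IsCompact.exists_isMaxOn`, `IsCompact.exists_bound_of_continuousOn`.

References: M. G. Crandall, H. Ishii, P.-L. Lions, Bull. AMS 27 (1992), §2–§3.
-/

noncomputable section

open Set Filter Topology Metric MeasureTheory
open scoped ContDiff

namespace Literature.Analysis.ODE

/-! ### The classical two-point solution of `A u'' + B u' = 0` -/

/-- A primitive `η ↦ ∫_α^η g` of a function smooth on an open interval containing `α` is smooth
there, with derivative `g`. [folklore] -/
theorem contDiffOn_primitive_of_contDiffOn {g : ℝ → ℝ} {a b α : ℝ} (hα : α ∈ Ioo a b)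
    (hg : ContDiffOn ℝ ∞ g (Ioo a b)) :
    ContDiffOn ℝ ∞ (fun η ↦ ∫ s in α..η, g s) (Ioo a b) ∧
      ∀ η ∈ Ioo a b, HasDerivAt (fun η ↦ ∫ s in α..η, g s) (g η) η := by
  have hgc : ContinuousOn g (Ioo a b) := hg.continuousOn
  have hderiv : ∀ η ∈ Ioo a b, HasDerivAt (fun η ↦ ∫ s in α..η, g s) (g η) η := by
    intro η hη
    have hsub : uIcc α η ⊆ Ioo a b := by
      rcases le_total α η with h | h
      · rw [uIcc_of_le h]; exact fun s hs ↦ ⟨hα.1.trans_le hs.1, hs.2.trans_lt hη.2⟩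
      · rw [uIcc_of_ge h]; exact fun s hs ↦ ⟨hη.1.trans_le hs.1, hs.2.trans_lt hα.2⟩
    refine intervalIntegral.integral_hasDerivAt_right ((hgc.mono hsub).intervalIntegrable)
      (hgc.stronglyMeasurableAtFilter isOpen_Ioo η hη) (hgc.continuousAt (Ioo_mem_nhds hη.1 hη.2))
  refine ⟨?_, hderiv⟩
  rw [contDiffOn_infty_iff_deriv_of_isOpen isOpen_Ioo]
  refine ⟨fun η hη ↦ (hderiv η hη).differentiableAt.differentiableWithinAt, ?_⟩
  exact hg.congr fun η hη ↦ (hderiv η hη).deriv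

/-- **Classical two-point solutions.**  For `A, B` smooth on `(a,b)` with `A > 0` and
`α, β ∈ (a,b)`, `α < β`, and prescribed values `yα, yβ`, there is a smooth `u` on `(a,b)` with
`u α = yα`, `u β = yβ` and `A u'' + B u' = 0` on `(a,b)`: `u = yα + c ∫_α exp(-∫_α B/A)`.
[folklore] -/
theorem exists_classical_twoPoint {A B : ℝ → ℝ} {a b α β : ℝ} (hα : α ∈ Ioo a b) (hβ : β ∈ Ioo a b)
    (hαβ : α < β) (hA : ContDiffOn ℝ ∞ A (Ioo a b)) (hB : ContDiffOn ℝ ∞ B (Ioo a b))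
    (hpos : ∀ η ∈ Ioo a b, 0 < A η) (yα yβ : ℝ) :
    ∃ u : ℝ → ℝ, ContDiffOn ℝ ∞ u (Ioo a b) ∧ u α = yα ∧ u β = yβ ∧
      ∀ η ∈ Ioo a b, A η * deriv (deriv u) η + B η * deriv u η = 0 := by
  -- `P = B/A`, its primitive `IP`, the integrating factor `E = exp(-IP)` and its primitive `Φ`
  set P : ℝ → ℝ := fun η ↦ B η / A η with hP
  have hPs : ContDiffOn ℝ ∞ P (Ioo a b) := hB.div hA fun η hη ↦ (hpos η hη).ne'
  obtain ⟨hIPs, hIPd⟩ := contDiffOn_primitive_of_contDiffOn hα hPs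
  set IP : ℝ → ℝ := fun η ↦ ∫ s in α..η, P s with hIP
  set E : ℝ → ℝ := fun η ↦ Real.exp (-IP η) with hE
  have hEs : ContDiffOn ℝ ∞ E (Ioo a b) := Real.contDiff_exp.comp_contDiffOn hIPs.neg
  have hEd : ∀ η ∈ Ioo a b, HasDerivAt E (E η * -P η) η := fun η hη ↦ by
    have := (hIPd η hη).neg.exp
    simpa [hE] using this
  have hEpos : ∀ η, 0 < E η := fun η ↦ Real.exp_pos _
  obtain ⟨hΦs, hΦd⟩ := contDiffOn_primitive_of_contDiffOn hα hEs
  set Φ : ℝ → ℝ := fun η ↦ ∫ s in α..η, E s with hΦ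
  have hΦα : Φ α = 0 := by simp [hΦ]
  have hΦβ : 0 < Φ β := by
    have hsub : Icc α β ⊆ Ioo a b := fun s hs ↦ ⟨hα.1.trans_le hs.1, hs.2.trans_lt hβ.2⟩
    refine intervalIntegral.intervalIntegral_pos_of_pos_on ?_ (fun η _ ↦ hEpos η) hαβ
    exact (hEs.continuousOn.mono (by rwa [uIcc_of_le hαβ.le])).intervalIntegrable
  set c := (yβ - yα) / Φ β with hc
  refine ⟨fun η ↦ yα + c * Φ η, ?_, ?_, ?_, ?_⟩
  · exact contDiffOn_const.add (contDiffOn_const.mul hΦs)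
  · simp [hΦα]
  · simp only [hc]; field_simp; ring
  · intro η hη
    have hud : ∀ η' ∈ Ioo a b, HasDerivAt (fun η ↦ yα + c * Φ η) (c * E η') η' := fun η' hη' ↦ by
      simpa using ((hΦd η' hη').const_mul c).const_add yα
    have hderiv1 : deriv (fun η ↦ yα + c * Φ η) η = c * E η := (hud η hη).deriv
    have hev : deriv (fun η ↦ yα + c * Φ η) =ᶠ[𝓝 η] fun η' ↦ c * E η' := by
      filter_upwards [Ioo_mem_nhds hη.1 hη.2] with η' hη'
      exact (hud η' hη').deriv
    have hderiv2 : deriv (deriv fun η ↦ yα + c * Φ η) η = c * (E η * -P η) := by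
      rw [hev.deriv_eq]
      exact ((hEd η hη).const_mul c).deriv
    rw [hderiv1, hderiv2]
    have hAne : A η ≠ 0 := (hpos η hη).ne'
    simp only [hP]
    field_simp
    ring

/-! ### Comparison: a viscosity subsolution lies below the classical solution -/

/-- A level `K` with `A K² + B K ≥ 1` on the compact `[α, β]` (where `A > 0`). [folklore] -/
theorem exists_level_of_pos {A B : ℝ → ℝ} {a b α β : ℝ} (hsub : Icc α β ⊆ Ioo a b) (hαβ : α ≤ β)
    (hA : ContinuousOn A (Ioo a b)) (hB : ContinuousOn B (Ioo a b)) (hpos : ∀ η ∈ Ioo a b, 0 < A η) :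
    ∃ K : ℝ, 0 < K ∧ ∀ η ∈ Icc α β, 1 ≤ A η * K ^ 2 + B η * K := by
  obtain ⟨ηm, hηm, hmin⟩ := (isCompact_Icc (a := α) (b := β)).exists_isMinOn (nonempty_Icc.2 hαβ)
    (hA.mono hsub)
  obtain ⟨B₀, hB₀⟩ := (isCompact_Icc (a := α) (b := β)).exists_bound_of_continuousOn (hB.mono hsub)
  set A₀ := A ηm with hA₀
  have hA₀pos : 0 < A₀ := hpos ηm (hsub hηm)
  have hB₀nn : 0 ≤ B₀ := (norm_nonneg _).trans (hB₀ α (left_mem_Icc.2 hαβ))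
  refine ⟨(B₀ + 1) / A₀ + 1, by positivity, fun η hη ↦ ?_⟩
  set K := (B₀ + 1) / A₀ + 1 with hK
  have hK1 : 1 ≤ K := by
    have h0 : 0 ≤ (B₀ + 1) / A₀ := by positivity
    rw [hK]; linarith
  have hAK : A₀ * K - B₀ = 1 + A₀ := by rw [hK]; field_simp; ring
  have hAη : A₀ ≤ A η := hmin hη
  have hBη : -B₀ ≤ B η := by
    have := hB₀ η hη; rw [Real.norm_eq_abs] at this; exact neg_le_of_abs_le this
  have hK0 : 0 ≤ K := by linarith
  calc (1 : ℝ) ≤ K * (A₀ * K - B₀) := by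
        rw [hAK]; nlinarith
    _ = A₀ * K ^ 2 + (-B₀) * K := by ring
    _ ≤ A η * K ^ 2 + B η * K := by
        have h1 : A₀ * K ^ 2 ≤ A η * K ^ 2 := mul_le_mul_of_nonneg_right hAη (by positivity)
        have h2 : (-B₀) * K ≤ B η * K := mul_le_mul_of_nonneg_right hBη hK0
        linarith

/-- **Upper comparison.**  If every smooth `φ` touching the continuous `f` from above at a point
of `(a,b)` has `A φ'' + B φ' ≥ 0` there (`A > 0`), and `u` is a classical solution of
`A u'' + B u' = 0`, smooth on `(a,b)`, with `u = f` at `α < β` (`[α,β] ⊂ (a,b)`), then `f ≤ u`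
on `[α, β]`: otherwise `u + ε (e^{K(β+1)} - e^{Kη}) + max` touches `f` from above at an interior
point where `A φ'' + B φ' = -ε e^{Kη}(A K² + B K) < 0`. [cite: CrandallIshiiLions1992, §3] -/
theorem le_classical_of_touchingAbove {f u A B : ℝ → ℝ} {a b α β : ℝ}
    (hf : ContinuousOn f (Ioo a b)) (hA : ContDiffOn ℝ ∞ A (Ioo a b))
    (hB : ContDiffOn ℝ ∞ B (Ioo a b)) (hpos : ∀ η ∈ Ioo a b, 0 < A η)
    (habove : ∀ η₀ ∈ Ioo a b, ∀ φ : ℝ → ℝ, ContDiff ℝ ∞ φ → φ η₀ = f η₀ →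
      (∀ᶠ η in 𝓝 η₀, f η ≤ φ η) → 0 ≤ A η₀ * deriv (deriv φ) η₀ + B η₀ * deriv φ η₀)
    (hu : ContDiffOn ℝ ∞ u (Ioo a b))
    (hode : ∀ η ∈ Ioo a b, A η * deriv (deriv u) η + B η * deriv u η = 0)
    (hα : α ∈ Ioo a b) (hβ : β ∈ Ioo a b) (hαβ : α < β) (huα : u α = f α) (huβ : u β = f β) :
    ∀ η ∈ Icc α β, f η ≤ u η := by
  have hsub : Icc α β ⊆ Ioo a b := fun s hs ↦ ⟨hα.1.trans_le hs.1, hs.2.trans_lt hβ.2⟩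
  obtain ⟨K, hKpos, hK⟩ := exists_level_of_pos hsub hαβ.le hA.continuousOn hB.continuousOn hpos
  -- the perturbation `w = e^{K(β+1)} - e^{Kη} > 0` on `[α, β]` and its derivatives
  set w : ℝ → ℝ := fun η ↦ Real.exp (K * (β + 1)) - Real.exp (K * η) with hw
  have hwpos : ∀ η ∈ Icc α β, 0 < w η := fun η hη ↦ by
    simp only [hw]
    have : K * η < K * (β + 1) := by nlinarith [hη.2]
    linarith [Real.exp_lt_exp.2 this]
  have hwd : ∀ η, HasDerivAt w (-(Real.exp (K * η) * K)) η := fun η ↦ by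
    have h1 : HasDerivAt (fun η ↦ Real.exp (K * η)) (Real.exp (K * η) * K) η := by
      simpa using ((hasDerivAt_id η).const_mul K).exp
    exact h1.const_sub (Real.exp (K * (β + 1)))
  have hwd2 : ∀ η, HasDerivAt (deriv w) (-(Real.exp (K * η) * K * K)) η := fun η ↦ by
    have hfun : deriv w = fun η ↦ -(Real.exp (K * η) * K) := funext fun η ↦ (hwd η).deriv
    rw [hfun]
    have h1 : HasDerivAt (fun η ↦ Real.exp (K * η)) (Real.exp (K * η) * K) η := by
      simpa using ((hasDerivAt_id η).const_mul K).exp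
    exact (h1.mul_const K).neg
  -- derivatives of `u`
  have hu1 : ∀ η ∈ Ioo a b, HasDerivAt u (deriv u η) η := fun η hη ↦
    ((hu.differentiableOn (by simp)).differentiableAt (Ioo_mem_nhds hη.1 hη.2)).hasDerivAt
  have hu' : ContDiffOn ℝ ∞ (deriv u) (Ioo a b) :=
    ((contDiffOn_infty_iff_deriv_of_isOpen isOpen_Ioo).1 hu).2
  have hu2 : ∀ η ∈ Ioo a b, HasDerivAt (deriv u) (deriv (deriv u) η) η := fun η hη ↦
    ((hu'.differentiableOn (by simp)).differentiableAt (Ioo_mem_nhds hη.1 hη.2)).hasDerivAt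
  -- `f ≤ u + ε w` for every `ε > 0`
  have main : ∀ ε : ℝ, 0 < ε → ∀ η ∈ Icc α β, f η ≤ u η + ε * w η := by
    intro ε hε
    by_contra hcon
    push Not at hcon
    obtain ⟨η₂, hη₂, hη₂lt⟩ := hcon
    set g : ℝ → ℝ := fun η ↦ f η - u η - ε * w η with hg
    have hgc : ContinuousOn g (Icc α β) := by
      refine ((hf.mono hsub).sub (hu.continuousOn.mono hsub)).sub ?_
      exact (continuousOn_const.mul (continuous_iff_continuousAt.2 fun η ↦
        (hwd η).continuousAt).continuousOn)
    obtain ⟨ηs, hηs, hmax⟩ := (isCompact_Icc (a := α) (b := β)).exists_isMaxOn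
      (nonempty_Icc.2 hαβ.le) hgc
    set M := g ηs with hM
    have hMpos : 0 < M := (show 0 < g η₂ by simp only [hg]; linarith).trans_le (hmax hη₂)
    have hgα : g α < 0 := by
      simp only [hg, huα]; have := hwpos α (left_mem_Icc.2 hαβ.le); nlinarith
    have hgβ : g β < 0 := by
      simp only [hg, huβ]; have := hwpos β (right_mem_Icc.2 hαβ.le); nlinarith
    have hηsα : ηs ≠ α := fun h ↦ by rw [hM, h] at hMpos; linarith
    have hηsβ : ηs ≠ β := fun h ↦ by rw [hM, h] at hMpos; linarith
    have hηs_int : ηs ∈ Ioo α β :=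
      ⟨lt_of_le_of_ne hηs.1 (Ne.symm hηsα), lt_of_le_of_ne hηs.2 hηsβ⟩
    have hηs_ab : ηs ∈ Ioo a b := hsub hηs
    -- the test function `φ₀ = u + ε w + M` touches `f` from above at `ηs`
    set φ₀ : ℝ → ℝ := fun η ↦ u η + ε * w η + M with hφ₀
    have hφ₀eq : φ₀ ηs = f ηs := by simp only [hφ₀, hM, hg]; ring
    have hφ₀ge : ∀ᶠ η in 𝓝 ηs, f η ≤ φ₀ η := by
      filter_upwards [Ioo_mem_nhds hηs_int.1 hηs_int.2] with η hη
      have hle : g η ≤ g ηs := hmax (show η ∈ Icc α β from ⟨hη.1.le, hη.2.le⟩)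
      simp only [hφ₀, hM, hg] at hle ⊢
      linarith
    have hφ₀s : ContDiffOn ℝ ∞ φ₀ (Ioo a b) := by
      refine (hu.add (contDiffOn_const.mul ?_)).add contDiffOn_const
      simp only [hw]
      exact (contDiff_const.sub (Real.contDiff_exp.comp (contDiff_const.mul contDiff_id))).contDiffOn
    have hφ₀d : ∀ η ∈ Ioo a b, HasDerivAt φ₀ (deriv u η + ε * -(Real.exp (K * η) * K)) η :=
      fun η hη ↦ by
        simpa [hφ₀] using ((hu1 η hη).add ((hwd η).const_mul ε)).add_const M
    have hφ₀d1 : deriv φ₀ ηs = deriv u ηs + ε * -(Real.exp (K * ηs) * K) := (hφ₀d ηs hηs_ab).deriv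
    have hφ₀d2 : deriv (deriv φ₀) ηs = deriv (deriv u) ηs + ε * -(Real.exp (K * ηs) * K * K) := by
      have hev : deriv φ₀ =ᶠ[𝓝 ηs] fun η ↦ deriv u η + ε * deriv w η := by
        filter_upwards [Ioo_mem_nhds hηs_ab.1 hηs_ab.2] with η hη
        rw [(hφ₀d η hη).deriv, (hwd η).deriv]
      rw [hev.deriv_eq]
      exact ((hu2 ηs hηs_ab).add ((hwd2 ηs).const_mul ε)).deriv
    obtain ⟨φ, hφs, hφeq⟩ :=
      exists_contDiff_eventuallyEq (Ioo_mem_nhds hηs_ab.1 hηs_ab.2) hφ₀s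
    have key := habove ηs hηs_ab φ hφs (by rw [hφeq.eq_of_nhds, hφ₀eq])
      (by filter_upwards [hφeq, hφ₀ge] with η h1 h2; rw [h1]; exact h2)
    rw [hφeq.deriv_eq, hφeq.deriv.deriv_eq, hφ₀d1, hφ₀d2] at key
    have hode' := hode ηs hηs_ab
    have hK' := hK ηs hηs
    have hexp : 0 < Real.exp (K * ηs) := Real.exp_pos _
    have hApos := hpos ηs hηs_ab
    -- `0 ≤ (A u'' + B u') - ε e^{Kηs} (A K² + B K) ≤ -ε e^{Kηs} < 0`
    nlinarith [mul_pos hε hexp]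
  -- let `ε → 0`
  intro η hη
  have hwη := hwpos η hη
  refine le_of_forall_pos_le_add fun δ hδ ↦ ?_
  have := main (δ / w η) (div_pos hδ hwη) η hη
  rwa [div_mul_cancel₀ _ hwη.ne'] at this


/-- **Lower comparison** (the upper comparison for `-f`, `-u`): touching from below with
`A φ'' + B φ' ≤ 0` keeps `f` above the classical solution with the same two-point values.
[cite: CrandallIshiiLions1992, §3] -/
theorem classical_le_of_touchingBelow {f u A B : ℝ → ℝ} {a b α β : ℝ}
    (hf : ContinuousOn f (Ioo a b)) (hA : ContDiffOn ℝ ∞ A (Ioo a b))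
    (hB : ContDiffOn ℝ ∞ B (Ioo a b)) (hpos : ∀ η ∈ Ioo a b, 0 < A η)
    (hbelow : ∀ η₀ ∈ Ioo a b, ∀ φ : ℝ → ℝ, ContDiff ℝ ∞ φ → φ η₀ = f η₀ →
      (∀ᶠ η in 𝓝 η₀, φ η ≤ f η) → A η₀ * deriv (deriv φ) η₀ + B η₀ * deriv φ η₀ ≤ 0)
    (hu : ContDiffOn ℝ ∞ u (Ioo a b))
    (hode : ∀ η ∈ Ioo a b, A η * deriv (deriv u) η + B η * deriv u η = 0)
    (hα : α ∈ Ioo a b) (hβ : β ∈ Ioo a b) (hαβ : α < β) (huα : u α = f α) (huβ : u β = f β) :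
    ∀ η ∈ Icc α β, u η ≤ f η := by
  have hderiv_neg : ∀ (v : ℝ → ℝ) (η : ℝ), deriv (fun η ↦ -v η) η = -deriv v η :=
    fun v η ↦ deriv.neg
  have hderiv_neg2 : ∀ (v : ℝ → ℝ) (η : ℝ), deriv (deriv fun η ↦ -v η) η = -deriv (deriv v) η := by
    intro v η
    have : deriv (fun η ↦ -v η) = fun η ↦ -deriv v η := funext fun η ↦ deriv.neg
    rw [this]
    exact deriv.neg
  have key := le_classical_of_touchingAbove (f := fun η ↦ -f η) (u := fun η ↦ -u η) hf.neg hA hB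
    hpos ?_ hu.neg ?_ hα hβ hαβ (by simp [huα]) (by simp [huβ])
  · intro η hη
    have := key η hη
    simpa using this
  · intro η₀ hη₀ φ hφ hφeq hφle
    have h := hbelow η₀ hη₀ (fun η ↦ -φ η) hφ.neg (by simp [hφeq])
      (by filter_upwards [hφle] with η hη; linarith)
    rw [hderiv_neg, hderiv_neg2] at h
    linarith
  · intro η hη
    rw [hderiv_neg, hderiv_neg2]
    have := hode η hη
    linarith

/-! ### The theorem -/

/-- **Continuous viscosity solutions of a nondegenerate linear second-order ODE are classical.**
Let `f` be continuous on `(a,b)`, `A, B` smooth on `(a,b)` with `A > 0`.  If every smooth `φ`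
touching `f` from above at `η₀ ∈ (a,b)` (`φ η₀ = f η₀`, `f ≤ φ` near `η₀`) satisfies
`0 ≤ A η₀ φ''(η₀) + B η₀ φ'(η₀)` and every smooth `φ` touching `f` from below satisfies
`A η₀ φ''(η₀) + B η₀ φ'(η₀) ≤ 0`, then `f` is smooth on `(a,b)` and `A f'' + B f' = 0` there.
(On each `[α, β] ⊂ (a,b)`, `f` coincides with the classical two-point solution by the two
comparison lemmas.) [cite: CrandallIshiiLions1992, §3] -/
theorem contDiffOn_and_ode_of_touching {f A B : ℝ → ℝ} {a b : ℝ}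
    (hf : ContinuousOn f (Ioo a b)) (hA : ContDiffOn ℝ ∞ A (Ioo a b))
    (hB : ContDiffOn ℝ ∞ B (Ioo a b)) (hpos : ∀ η ∈ Ioo a b, 0 < A η)
    (habove : ∀ η₀ ∈ Ioo a b, ∀ φ : ℝ → ℝ, ContDiff ℝ ∞ φ → φ η₀ = f η₀ →
      (∀ᶠ η in 𝓝 η₀, f η ≤ φ η) → 0 ≤ A η₀ * deriv (deriv φ) η₀ + B η₀ * deriv φ η₀)
    (hbelow : ∀ η₀ ∈ Ioo a b, ∀ φ : ℝ → ℝ, ContDiff ℝ ∞ φ → φ η₀ = f η₀ →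
      (∀ᶠ η in 𝓝 η₀, φ η ≤ f η) → A η₀ * deriv (deriv φ) η₀ + B η₀ * deriv φ η₀ ≤ 0) :
    ContDiffOn ℝ ∞ f (Ioo a b) ∧
      ∀ η ∈ Ioo a b, A η * deriv (deriv f) η + B η * deriv f η = 0 := by
  -- near every point, `f` agrees with a classical solution
  have hloc : ∀ η₀ ∈ Ioo a b, ∃ u : ℝ → ℝ, ContDiffOn ℝ ∞ u (Ioo a b) ∧
      (∀ η ∈ Ioo a b, A η * deriv (deriv u) η + B η * deriv u η = 0) ∧ f =ᶠ[𝓝 η₀] u := by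
    intro η₀ hη₀
    set α := (a + η₀) / 2 with hαdef
    set β := (η₀ + b) / 2 with hβdef
    have hα : α ∈ Ioo a b := ⟨by rw [hαdef]; linarith [hη₀.1], by rw [hαdef]; linarith [hη₀.1, hη₀.2]⟩
    have hβ : β ∈ Ioo a b := ⟨by rw [hβdef]; linarith [hη₀.1, hη₀.2], by rw [hβdef]; linarith [hη₀.2]⟩
    have hαη₀ : α < η₀ := by rw [hαdef]; linarith [hη₀.1]
    have hη₀β : η₀ < β := by rw [hβdef]; linarith [hη₀.2]
    have hαβ : α < β := hαη₀.trans hη₀β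
    obtain ⟨u, hu, huα, huβ, hode⟩ := exists_classical_twoPoint hα hβ hαβ hA hB hpos (f α) (f β)
    have hle := le_classical_of_touchingAbove hf hA hB hpos habove hu hode hα hβ hαβ huα huβ
    have hge := classical_le_of_touchingBelow hf hA hB hpos hbelow hu hode hα hβ hαβ huα huβ
    refine ⟨u, hu, hode, ?_⟩
    filter_upwards [Ioo_mem_nhds hαη₀ hη₀β] with η hη
    exact le_antisymm (hle η ⟨hη.1.le, hη.2.le⟩) (hge η ⟨hη.1.le, hη.2.le⟩)
  refine ⟨fun η₀ hη₀ ↦ ?_, fun η₀ hη₀ ↦ ?_⟩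
  · obtain ⟨u, hu, -, hfu⟩ := hloc η₀ hη₀
    exact ((hu.contDiffAt (Ioo_mem_nhds hη₀.1 hη₀.2)).congr_of_eventuallyEq hfu).contDiffWithinAt
  · obtain ⟨u, -, hode, hfu⟩ := hloc η₀ hη₀
    rw [hfu.deriv_eq, hfu.deriv.deriv_eq]
    exact hode η₀ hη₀

end Literature.Analysis.ODE

end
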